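import Literature.Topology.FourManifolds.IwaseHandleEmbedding
import HarnessLib

/-!
# The model diffeomorphism on the handle and its agreement with the polar model

Auxiliary construction for the model datum of Iwase's Proposition 3.5
[cite: Iwase1988, Prop. 3.5, p. 296; proof p. 297] (`Iwase1988_gluckTwist_isTorusLinkSurgery`,
reduced to a model problem on `S² × ℝ²` in `TorusSurgeryIwaseReduction`).  On the handle
`Hset` (`IwaseHandleEmbedding`) the model map is the conjugate by the handle chart `h` of the
slice surgery `Θ` of the slice model (`UnknotSurgeryModel`) with the `s`-dependent affine profile
`prof s = gaff (mfun s)`, followed by the inverse Gluck map: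
`Φ_H = G⁻¹ ∘ h ∘ Θ̂ ∘ h⁻¹` (`PhiH`), `Ψ_H = h ∘ Θ̂⁻¹ ∘ h⁻¹ ∘ G` (`PsiH`).

Main results:
* `ThetaS`, `ThetaSInv`: the slice surgery along the handle; inverse identities off the core,
  shape preservation, box invariance, `= id` where the radial cut-off is complete, mirror
  symmetry, joint smoothness off the core (`contDiffAt_ThetaS`).
* `PsiH_PhiH`, `PhiH_PsiH`, `PhiH_eq_gluckMapInv` (cut-off complete), `contMDiffAt_PhiH`,
  `contMDiffAt_PsiH`, `PhiH_mirror`, band lemmas (`end_of_rad_lt`, `norm_PhiH_snd_lt_iff`).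
* **The matching** `PhiH_eq_polarMap`: on the band `‖w‖ < 197/200` of the handle, off the core,
  `Φ_H` *equals* the polar model `IwasePolar.polarMap`.  Ingredients: the end normal form and
  equivariance of `h` (`handleMap_mul_of_le`), `K(s) = 1 - r` on the band (`Kfun_eq_of_le`), the
  identities `afun_eq_polar_afun` (the two `A`-functions), `cutoff_eq_muP` (the two cut-offs) and
  `phaseRaw_eq_bfun` (raw slice phase = polar `B`-function; where the cut-off is incomplete,
  `‖ζ‖² < 5` forces `x ≤ 1/10`, where the bump profile is affine), and the rotation algebra
  `rotateSphereTwo_circleOf_mul`; the southern band follows by the mirror symmetry.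

All statements are elementary [folklore] except the role of `Θ` in Iwase's proof (cited).

## References
* Z. Iwase, *Dehn-surgery along a torus T²-knot*, Pacific J. Math. 133 (1988), 289–299,
  Prop. 3.5. [cite: Iwase1988]
-/

open scoped ContDiff Manifold Topology
open Set Function Real Metric

noncomputable section

namespace Literature.Topology.FourManifolds

namespace IwaseHandle

open HandlePlanar UnknotSurgery

/-! ### Rotation algebra on `S²` -/

/-- Composition of rotations about the polar axis corresponds to multiplication of unit complex
numbers. [folklore] -/
theorem rotateSphereTwo_circleOf_mul {u v : ℂ} (hu : ‖u‖ = 1) (hv : ‖v‖ = 1)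
    (p : sphere (0 : EuclideanSpace ℝ (Fin 3)) 1) :
    rotateSphereTwo (IwasePolar.circleOf u) (rotateSphereTwo (IwasePolar.circleOf v) p) =
      rotateSphereTwo (IwasePolar.circleOf (u * v)) p := by
  have huv : ‖u * v‖ = 1 := by rw [norm_mul, hu, hv, mul_one]
  apply Subtype.ext
  ext i
  fin_cases i
  · simp [IwasePolar.coe_circleOf hu, IwasePolar.coe_circleOf hv, IwasePolar.coe_circleOf huv]
    ring
  · simp [IwasePolar.coe_circleOf hu, IwasePolar.coe_circleOf hv, IwasePolar.coe_circleOf huv]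
    ring
  · simp

/-- Rotations about the polar axis commute with the mirror. [folklore] -/
theorem rotateSphereTwo_mirrorS2 (u : sphere (0 : EuclideanSpace ℝ (Fin 2)) 1)
    (p : sphere (0 : EuclideanSpace ℝ (Fin 3)) 1) :
    rotateSphereTwo u (mirrorS2 p) = mirrorS2 (rotateSphereTwo u p) := by
  apply Subtype.ext
  ext i
  fin_cases i <;> simp

/-- The mirror preserves `x = ‖y‖²`. [folklore] -/
theorem xsq_mirrorS2 (p : sphere (0 : EuclideanSpace ℝ (Fin 3)) 1) :
    IwasePolar.xsq (mirrorS2 p) = IwasePolar.xsq p := by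
  simp [IwasePolar.xsq_eq]

/-- The inverse Gluck map commutes with the mirror. [folklore] -/
theorem gluckMapInv_mirror (p : sphere (0 : EuclideanSpace ℝ (Fin 3)) 1)
    (w : EuclideanSpace ℝ (Fin 2)) :
    gluckMapInv (mirrorS2 p, w) = (mirrorS2 (gluckMapInv (p, w)).1, w) := by
  by_cases hw : w = 0
  · subst hw
    simp [gluckMapInv]
  · rw [gluckMapInv_eq_of_ne_zero (p := (mirrorS2 p, w)) hw,
      gluckMapInv_eq_of_ne_zero (p := (p, w)) hw]
    simp [rotateSphereTwo_mirrorS2]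

/-- The Gluck map commutes with the mirror. [folklore] -/
theorem gluckMap_mirror (p : sphere (0 : EuclideanSpace ℝ (Fin 3)) 1)
    (w : EuclideanSpace ℝ (Fin 2)) :
    gluckMap (mirrorS2 p, w) = (mirrorS2 (gluckMap (p, w)).1, w) := by
  by_cases hw : w = 0
  · subst hw
    simp
  · rw [gluckMap_eq_of_ne_zero (p := (mirrorS2 p, w)) hw, gluckMap_eq_of_ne_zero (p := (p, w)) hw]
    simp [rotateSphereTwo_mirrorS2]

/-- The polar model commutes with the mirror. [folklore] -/
theorem polarMap_mirror (p : sphere (0 : EuclideanSpace ℝ (Fin 3)) 1)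
    (w : EuclideanSpace ℝ (Fin 2)) :
    IwasePolar.polarMap (mirrorS2 p, w) = (mirrorS2 (IwasePolar.polarMap (p, w)).1, w) := by
  simp [IwasePolar.polarMap, IwasePolar.polS, xsq_mirrorS2, rotateSphereTwo_mirrorS2]

/-- The inverse polar model commutes with the mirror. [folklore] -/
theorem polarMapInv_mirror (p : sphere (0 : EuclideanSpace ℝ (Fin 3)) 1)
    (w : EuclideanSpace ℝ (Fin 2)) :
    IwasePolar.polarMapInv (mirrorS2 p, w) = (mirrorS2 (IwasePolar.polarMapInv (p, w)).1, w) := by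
  simp [IwasePolar.polarMapInv, IwasePolar.polS, xsq_mirrorS2, rotateSphereTwo_mirrorS2]

/-! ### The slice surgery along the handle -/

/-- The slice profile at parameter `s`: the affine profile `gaff m(s)`. [folklore] -/
def prof (s : ℝ) : ℝ → ℝ := gaff (mfun s)

/-- The profile family is mirror-symmetric. [folklore] -/
theorem prof_one_sub (s : ℝ) : prof (1 - s) = prof s := by rw [prof, prof, mfun_one_sub]

/-- The radial cut-off is admissible for every slice profile. [folklore] -/
theorem prof_admissible (s : ℝ) : IsAdmissibleCutoff (prof s) cutoff :=
  isAdmissibleCutoff_cutoff (lt_one_of_one_lt_gaff (mfun_pos s))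

/-- `prof s u = 1 ↔ u = 1`. [folklore] -/
theorem prof_eq_one (s : ℝ) : ∀ u, prof s u = 1 → u = 1 :=
  eq_one_of_gaff_eq_one (mfun_pos s).ne'

/-- The slice data are tube-adapted with slope `m(s)`. [folklore] -/
theorem prof_tubeAdapted (s : ℝ) : IsTubeAdapted (prof s) cutoff (mfun s) :=
  isTubeAdapted_gaff_cutoff (mfun_pos s)

/-- The cut-off only depends on `(‖ζ‖, c)`. [folklore] -/
theorem cutoff_norm : ∀ p p' : ℂ × ℝ, ‖p.1‖ = ‖p'.1‖ → p.2 = p'.2 → cutoff p = cutoff p' :=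
  fun _ _ h1 h2 => cutoff_eq_of_norm_eq h1 h2

/-- The cut-off is complete beyond height `3 < π`. [folklore] -/
theorem cutoff_far : ∀ (_ : ℝ) (p : ℂ × ℝ), 3 < |p.2| → cutoff p = 1 :=
  fun _ _ hp => cutoff_eq_one_of_lt hp

/-- The profile family is jointly smooth. [folklore] -/
theorem contDiff_prof : ContDiff ℝ ∞ fun q : ℝ × ℝ => prof q.1 q.2 := by
  unfold prof gaff
  exact contDiff_const.sub ((contDiff_mfun.comp contDiff_fst).mul (contDiff_snd.sub contDiff_const))

/-- **The slice surgery** `Θ̂(s, ζ, c) = (s, Θ_s(ζ, c))` along the handle. [folklore] -/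
def ThetaS (u : ℝ × ℂ × ℝ) : ℝ × ℂ × ℝ := (u.1, theta (prof u.1) cutoff u.2)

/-- The inverse slice surgery. [folklore] -/
def ThetaSInv (u : ℝ × ℂ × ℝ) : ℝ × ℂ × ℝ := (u.1, thetaInv (prof u.1) cutoff u.2)

/-- `Θ̂⁻¹ ∘ Θ̂ = id` off the core. [folklore] -/
theorem ThetaSInv_ThetaS {u : ℝ × ℂ × ℝ} (hu : u.2 ∉ UnknotSurgery.unknot) : ThetaSInv (ThetaS u) = u := by
  obtain ⟨s, p⟩ := u
  simp only [ThetaS, ThetaSInv, Prod.mk.injEq, true_and]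
  exact thetaInv_theta (prof_admissible s) (prof_eq_one s) cutoff_norm hu

/-- `Θ̂ ∘ Θ̂⁻¹ = id` off the core. [folklore] -/
theorem ThetaS_ThetaSInv {u : ℝ × ℂ × ℝ} (hu : u.2 ∉ UnknotSurgery.unknot) : ThetaS (ThetaSInv u) = u := by
  obtain ⟨s, p⟩ := u
  simp only [ThetaS, ThetaSInv, Prod.mk.injEq, true_and]
  exact theta_thetaInv (prof_admissible s) (prof_eq_one s) cutoff_norm hu

/-- `Θ̂` preserves `s`, `‖ζ‖` and `c` off the core. [folklore] -/
theorem ThetaS_shape {u : ℝ × ℂ × ℝ} (hu : u.2 ∉ UnknotSurgery.unknot) :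
    (ThetaS u).1 = u.1 ∧ ‖(ThetaS u).2.1‖ = ‖u.2.1‖ ∧ (ThetaS u).2.2 = u.2.2 :=
  ⟨rfl, norm_theta_fst (prof_admissible u.1) (prof_eq_one u.1) hu, rfl⟩

/-- `Θ̂⁻¹` preserves `s`, `‖ζ‖` and `c` off the core. [folklore] -/
theorem ThetaSInv_shape {u : ℝ × ℂ × ℝ} (hu : u.2 ∉ UnknotSurgery.unknot) :
    (ThetaSInv u).1 = u.1 ∧ ‖(ThetaSInv u).2.1‖ = ‖u.2.1‖ ∧ (ThetaSInv u).2.2 = u.2.2 :=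
  ⟨rfl, norm_thetaInv_fst (prof_admissible u.1) (prof_eq_one u.1) hu, rfl⟩

/-- `Θ̂` maps off-core points to off-core points. [folklore] -/
theorem ThetaS_not_mem {u : ℝ × ℂ × ℝ} (hu : u.2 ∉ UnknotSurgery.unknot) : (ThetaS u).2 ∉ UnknotSurgery.unknot :=
  theta_not_mem (prof_admissible u.1) (prof_eq_one u.1) hu

/-- `Θ̂⁻¹` maps off-core points to off-core points. [folklore] -/
theorem ThetaSInv_not_mem {u : ℝ × ℂ × ℝ} (hu : u.2 ∉ UnknotSurgery.unknot) : (ThetaSInv u).2 ∉ UnknotSurgery.unknot :=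
  thetaInv_not_mem (prof_admissible u.1) (prof_eq_one u.1) hu

/-- On the core `Θ̂` is the junk value `(s, 0, c)`. [folklore] -/
theorem ThetaS_of_mem {u : ℝ × ℂ × ℝ} (hu : u.2 ∈ UnknotSurgery.unknot) : ThetaS u = (u.1, 0, u.2.2) := by
  obtain ⟨s, ζ, c⟩ := u
  have hA : afun (prof s) (ζ, c) = 0 := afun_eq_zero_of_mem (by simp [prof, gaff]) hu
  have hμ : cutoff (ζ, c) = 0 := by
    apply cutoff_eq_zero
    obtain ⟨h1, h2⟩ := hu
    simp only [sqRad] at h1 h2 ⊢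
    rw [h1, h2]; norm_num
  simp [ThetaS, theta, phase, phaseRaw, hA, hμ, nrm]

/-- `Θ̂` maps the box to itself. [folklore] -/
theorem ThetaS_mem_Ubox {u : ℝ × ℂ × ℝ} (hu : u ∈ Ubox) : ThetaS u ∈ Ubox := by
  by_cases hc : u.2 ∈ UnknotSurgery.unknot
  · rw [ThetaS_of_mem hc]
    exact ⟨hu.1, by simp, hu.2.2⟩
  · obtain ⟨h1, h2, h3⟩ := ThetaS_shape hc
    exact ⟨h1.symm ▸ hu.1, h2.symm ▸ hu.2.1, h3.symm ▸ hu.2.2⟩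

/-- On the core `Θ̂⁻¹` is the junk value `(s, 0, c)`. [folklore] -/
theorem ThetaSInv_of_mem {u : ℝ × ℂ × ℝ} (hu : u.2 ∈ UnknotSurgery.unknot) : ThetaSInv u = (u.1, 0, u.2.2) := by
  obtain ⟨s, ζ, c⟩ := u
  have hA : afun (prof s) (ζ, c) = 0 := afun_eq_zero_of_mem (by simp [prof, gaff]) hu
  have hμ : cutoff (ζ, c) = 0 := by
    apply cutoff_eq_zero
    obtain ⟨h1, h2⟩ := hu
    simp only [sqRad] at h1 h2 ⊢
    rw [h1, h2]; norm_num
  simp [ThetaSInv, thetaInv, phase, phaseRaw, hA, hμ, nrm]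

/-- `Θ̂⁻¹` maps the box to itself. [folklore] -/
theorem ThetaSInv_mem_Ubox {u : ℝ × ℂ × ℝ} (hu : u ∈ Ubox) : ThetaSInv u ∈ Ubox := by
  by_cases hc : u.2 ∈ UnknotSurgery.unknot
  · rw [ThetaSInv_of_mem hc]
    exact ⟨hu.1, by simp, hu.2.2⟩
  · obtain ⟨h1, h2, h3⟩ := ThetaSInv_shape hc
    exact ⟨h1.symm ▸ hu.1, h2.symm ▸ hu.2.1, h3.symm ▸ hu.2.2⟩

/-- `Θ̂` is the identity where the cut-off is complete. [folklore] -/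
theorem ThetaS_eq_self {u : ℝ × ℂ × ℝ} (hu : cutoff u.2 = 1) : ThetaS u = u := by
  obtain ⟨s, p⟩ := u
  simp only [ThetaS, Prod.mk.injEq, true_and]
  exact theta_eq_self hu

/-- `Θ̂⁻¹` is the identity where the cut-off is complete. [folklore] -/
theorem ThetaSInv_eq_self {u : ℝ × ℂ × ℝ} (hu : cutoff u.2 = 1) : ThetaSInv u = u := by
  obtain ⟨s, p⟩ := u
  simp only [ThetaSInv, Prod.mk.injEq, true_and]
  exact thetaInv_eq_self hu

/-- `Θ̂` is mirror-symmetric in `s`. [folklore] -/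
theorem ThetaS_one_sub (s : ℝ) (p : ℂ × ℝ) : ThetaS (1 - s, p) = (1 - s, (ThetaS (s, p)).2) := by
  simp [ThetaS, prof_one_sub]

/-- `Θ̂⁻¹` is mirror-symmetric in `s`. [folklore] -/
theorem ThetaSInv_one_sub (s : ℝ) (p : ℂ × ℝ) :
    ThetaSInv (1 - s, p) = (1 - s, (ThetaSInv (s, p)).2) := by
  simp [ThetaSInv, prof_one_sub]

/-- **`Θ̂` is smooth off the core** (jointly in `s` and the slice point). [folklore] -/
theorem contDiffAt_ThetaS {u : ℝ × ℂ × ℝ} (hu : u.2 ∉ UnknotSurgery.unknot) : ContDiffAt ℝ ∞ ThetaS u := by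
  obtain ⟨s, p⟩ := u
  have h := contDiffAt_theta_family (X := ℝ) (G := fun s => prof s) (μ := fun _ => cutoff)
    contDiff_prof (contDiff_cutoff.comp contDiff_snd) (c₃ := 3) (by linarith [pi_gt_three])
    cutoff_far (x := s) (prof_admissible s) (prof_eq_one s) hu
  exact contDiffAt_fst.prodMk h

/-- **`Θ̂⁻¹` is smooth off the core.** [folklore] -/
theorem contDiffAt_ThetaSInv {u : ℝ × ℂ × ℝ} (hu : u.2 ∉ UnknotSurgery.unknot) : ContDiffAt ℝ ∞ ThetaSInv u := by
  obtain ⟨s, p⟩ := u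
  have h := contDiffAt_thetaInv_family (X := ℝ) (G := fun s => prof s) (μ := fun _ => cutoff)
    contDiff_prof (contDiff_cutoff.comp contDiff_snd) (c₃ := 3) (by linarith [pi_gt_three])
    cutoff_far (x := s) (prof_admissible s) (prof_eq_one s) hu
  exact contDiffAt_fst.prodMk h

/-! ### The model maps on the handle -/

/-- **The model diffeomorphism on the handle**: `Φ_H = G⁻¹ ∘ h ∘ Θ̂ ∘ h⁻¹`.
[cite: Iwase1988, proof of Prop. 3.5 (p. 297)] -/
def PhiH (q : sphere (0 : EuclideanSpace ℝ (Fin 3)) 1 × EuclideanSpace ℝ (Fin 2)) :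
    sphere (0 : EuclideanSpace ℝ (Fin 3)) 1 × EuclideanSpace ℝ (Fin 2) :=
  gluckMapInv (handleMap (ThetaS (handleInv q)))

/-- **The inverse model map on the handle**: `Ψ_H = h ∘ Θ̂⁻¹ ∘ h⁻¹ ∘ G`. [folklore] -/
def PsiH (q : sphere (0 : EuclideanSpace ℝ (Fin 3)) 1 × EuclideanSpace ℝ (Fin 2)) :
    sphere (0 : EuclideanSpace ℝ (Fin 3)) 1 × EuclideanSpace ℝ (Fin 2) :=
  handleMap (ThetaSInv (handleInv (gluckMap q)))

/-- `Φ_H` on a parametrised handle point. [folklore] -/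
theorem PhiH_handleMap {u : ℝ × ℂ × ℝ} (hu : u ∈ Ubox) :
    PhiH (handleMap u) = gluckMapInv (handleMap (ThetaS u)) := by
  rw [PhiH, handleInv_handleMap_of_mem hu]

/-- The second component of a box point of the handle is non-zero. [folklore] -/
theorem handleMap_snd_ne_zero {u : ℝ × ℂ × ℝ} (hu : u ∈ Ubox) : (handleMap u).2 ≠ 0 := by
  obtain ⟨s, ζ, c⟩ := u
  obtain ⟨hs, hζ, _⟩ := Ubox_aux hu
  rw [← norm_ne_zero_iff, norm_handleMap_snd hs hζ]
  exact (rad_pos hs (neg_one_lt_aOf s hζ)).ne'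

/-- The second component of a handle point is non-zero. [folklore] -/
theorem snd_ne_zero_of_mem_Hset {q : sphere (0 : EuclideanSpace ℝ (Fin 3)) 1 × EuclideanSpace ℝ (Fin 2)}
    (hq : q ∈ Hset) : q.2 ≠ 0 := by
  rw [← handleMap_handleInv_of_mem hq]
  exact handleMap_snd_ne_zero (handleInv_mem_Ubox hq)

/-- `G (Φ_H q)` is the handle point `h(Θ̂(h⁻¹ q))`. [folklore] -/
theorem gluckMap_PhiH {q : sphere (0 : EuclideanSpace ℝ (Fin 3)) 1 × EuclideanSpace ℝ (Fin 2)}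
    (hq : q ∈ Hset) : gluckMap (PhiH q) = handleMap (ThetaS (handleInv q)) :=
  gluckMap_gluckMapInv (handleMap_snd_ne_zero (ThetaS_mem_Ubox (handleInv_mem_Ubox hq)))

/-- `G (Φ_H q) ∈ H` for `q ∈ H`. [folklore] -/
theorem gluckMap_PhiH_mem {q : sphere (0 : EuclideanSpace ℝ (Fin 3)) 1 × EuclideanSpace ℝ (Fin 2)}
    (hq : q ∈ Hset) : gluckMap (PhiH q) ∈ Hset := by
  rw [gluckMap_PhiH hq]
  exact handleMap_mem_Hset (ThetaS_mem_Ubox (handleInv_mem_Ubox hq))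

/-- **`Ψ_H ∘ Φ_H = id` on the handle off the core.** [folklore] -/
theorem PsiH_PhiH {q : sphere (0 : EuclideanSpace ℝ (Fin 3)) 1 × EuclideanSpace ℝ (Fin 2)}
    (hq : q ∈ Hset) (hc : (handleInv q).2 ∉ UnknotSurgery.unknot) : PsiH (PhiH q) = q := by
  rw [PsiH, gluckMap_PhiH hq, handleInv_handleMap_of_mem (ThetaS_mem_Ubox (handleInv_mem_Ubox hq)),
    ThetaSInv_ThetaS hc, handleMap_handleInv_of_mem hq]

/-- **`Φ_H ∘ Ψ_H = id`** at points `q` with `G q ∈ H` off the core. [folklore] -/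
theorem PhiH_PsiH {q : sphere (0 : EuclideanSpace ℝ (Fin 3)) 1 × EuclideanSpace ℝ (Fin 2)}
    (hq : gluckMap q ∈ Hset) (hc : (handleInv (gluckMap q)).2 ∉ UnknotSurgery.unknot) (hq0 : q.2 ≠ 0) :
    PhiH (PsiH q) = q := by
  rw [PsiH, PhiH, handleInv_handleMap_of_mem (ThetaSInv_mem_Ubox (handleInv_mem_Ubox hq)),
    ThetaS_ThetaSInv hc, handleMap_handleInv_of_mem hq, gluckMapInv_gluckMap hq0]

/-- `Ψ_H q ∈ H` when `G q ∈ H`. [folklore] -/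
theorem PsiH_mem {q : sphere (0 : EuclideanSpace ℝ (Fin 3)) 1 × EuclideanSpace ℝ (Fin 2)}
    (hq : gluckMap q ∈ Hset) : PsiH q ∈ Hset :=
  handleMap_mem_Hset (ThetaSInv_mem_Ubox (handleInv_mem_Ubox hq))

/-- **`Φ_H` is the inverse Gluck map where the slice cut-off is complete.** [folklore] -/
theorem PhiH_eq_gluckMapInv {q : sphere (0 : EuclideanSpace ℝ (Fin 3)) 1 × EuclideanSpace ℝ (Fin 2)}
    (hq : q ∈ Hset) (hcut : cutoff (handleInv q).2 = 1) : PhiH q = gluckMapInv q := by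
  rw [PhiH, ThetaS_eq_self hcut, handleMap_handleInv_of_mem hq]

/-- **`Ψ_H` is the Gluck map where the slice cut-off is complete.** [folklore] -/
theorem PsiH_eq_gluckMap {q : sphere (0 : EuclideanSpace ℝ (Fin 3)) 1 × EuclideanSpace ℝ (Fin 2)}
    (hq : gluckMap q ∈ Hset) (hcut : cutoff (handleInv (gluckMap q)).2 = 1) : PsiH q = gluckMap q := by
  rw [PsiH, ThetaSInv_eq_self hcut, handleMap_handleInv_of_mem hq]

/-- **`Φ_H` is smooth on the handle off the core.** [folklore] -/
theorem contMDiffAt_PhiH {q : sphere (0 : EuclideanSpace ℝ (Fin 3)) 1 × EuclideanSpace ℝ (Fin 2)}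
    (hq : q ∈ Hset) (hc : (handleInv q).2 ∉ UnknotSurgery.unknot) :
    ContMDiffAt ((𝓡 2).prod 𝓘(ℝ, EuclideanSpace ℝ (Fin 2)))
      ((𝓡 2).prod 𝓘(ℝ, EuclideanSpace ℝ (Fin 2))) ∞ PhiH q := by
  have hU := handleInv_mem_Ubox hq
  have hU' := ThetaS_mem_Ubox hU
  have h1 := contMDiffAt_handleInv_of_mem hq
  have h2 : ContMDiffAt 𝓘(ℝ, ℝ × ℂ × ℝ) 𝓘(ℝ, ℝ × ℂ × ℝ) ∞ ThetaS (handleInv q) :=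
    (contDiffAt_ThetaS hc).contMDiffAt
  have h3 := contMDiffAt_handleMap_of_mem hU'
  have h4 : ContMDiffAt ((𝓡 2).prod 𝓘(ℝ, EuclideanSpace ℝ (Fin 2)))
      ((𝓡 2).prod 𝓘(ℝ, EuclideanSpace ℝ (Fin 2))) ∞ gluckMapInv (handleMap (ThetaS (handleInv q))) :=
    contMDiffOn_gluckMapInv.contMDiffAt
      ((isOpen_ne_fun continuous_snd continuous_const).mem_nhds (handleMap_snd_ne_zero hU'))
  exact h4.comp q (h3.comp q (h2.comp q h1))

/-- **`Ψ_H` is smooth at points `q` with `G q` on the handle off the core.** [folklore] -/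
theorem contMDiffAt_PsiH {q : sphere (0 : EuclideanSpace ℝ (Fin 3)) 1 × EuclideanSpace ℝ (Fin 2)}
    (hq : gluckMap q ∈ Hset) (hc : (handleInv (gluckMap q)).2 ∉ UnknotSurgery.unknot) (hq0 : q.2 ≠ 0) :
    ContMDiffAt ((𝓡 2).prod 𝓘(ℝ, EuclideanSpace ℝ (Fin 2)))
      ((𝓡 2).prod 𝓘(ℝ, EuclideanSpace ℝ (Fin 2))) ∞ PsiH q := by
  have hG : ContMDiffOn ((𝓡 2).prod 𝓘(ℝ, EuclideanSpace ℝ (Fin 2)))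
      ((𝓡 2).prod 𝓘(ℝ, EuclideanSpace ℝ (Fin 2))) ∞ gluckMap
      {p : sphere (0 : EuclideanSpace ℝ (Fin 3)) 1 × EuclideanSpace ℝ (Fin 2) | p.2 ≠ 0} :=
    contMDiffOn_gluckMap_holds
  have h0 : ContMDiffAt ((𝓡 2).prod 𝓘(ℝ, EuclideanSpace ℝ (Fin 2)))
      ((𝓡 2).prod 𝓘(ℝ, EuclideanSpace ℝ (Fin 2))) ∞ gluckMap q :=
    hG.contMDiffAt ((isOpen_ne_fun continuous_snd continuous_const).mem_nhds hq0)
  have hU := handleInv_mem_Ubox hq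
  have hU' := ThetaSInv_mem_Ubox hU
  have h1 := contMDiffAt_handleInv_of_mem hq
  have h2 : ContMDiffAt 𝓘(ℝ, ℝ × ℂ × ℝ) 𝓘(ℝ, ℝ × ℂ × ℝ) ∞ ThetaSInv (handleInv (gluckMap q)) :=
    (contDiffAt_ThetaSInv hc).contMDiffAt
  have h3 := contMDiffAt_handleMap_of_mem hU'
  exact h3.comp q (h2.comp q (h1.comp q h0))

/-! ### Mirror symmetry of the model maps -/

/-- `Φ_H` commutes with the mirror on the handle. [folklore] -/
theorem PhiH_mirror {q : sphere (0 : EuclideanSpace ℝ (Fin 3)) 1 × EuclideanSpace ℝ (Fin 2)}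
    (hq : q ∈ Hset) : PhiH (mirrorS2 q.1, q.2) = (mirrorS2 (PhiH q).1, (PhiH q).2) := by
  have hq' : q ∈ handleMap '' Ubox := by rw [image_handleMap_Ubox]; exact hq
  obtain ⟨⟨s, p⟩, hu, rfl⟩ := hq'
  have hu' : ((1 - s, p) : ℝ × ℂ × ℝ) ∈ Ubox :=
    ⟨⟨by linarith [hu.1.2], by linarith [hu.1.1]⟩, hu.2.1, hu.2.2⟩
  have hmir := handleMap_one_sub s p.1 p.2
  simp only [Prod.mk.eta] at hmir
  rw [← hmir, PhiH_handleMap hu', PhiH_handleMap hu, ThetaS_one_sub, gluckMapInv_snd,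
    show ((1 - s, (ThetaS (s, p)).2) : ℝ × ℂ × ℝ) = (1 - (ThetaS (s, p)).1, ((ThetaS (s, p)).2.1,
      (ThetaS (s, p)).2.2)) from rfl, handleMap_one_sub]
  exact gluckMapInv_mirror _ _

/-! ### The band: where the handle meets the polar region -/

/-- **In the band `r < 197/200` the slice parameter is within `1/500` of an end.** [folklore] -/
theorem end_of_rad_lt {s : ℝ} (hs : s ∈ Icc (0 : ℝ) 1) {ζ : ℂ} (hζ : ‖ζ‖ ≤ 5 / 2)
    (h : rad s (aOf s ζ) < 197 / 200) : s ≤ 1 / 500 ∨ 499 / 500 ≤ s := by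
  have ha := abs_aOf_le s hζ
  rcases le_or_gt s (1 / 10) with h1 | h1
  · left
    rw [rad_eq_of_le hs.1 h1 ha] at h
    exact le_of_tan_le hs.1 h1 (by linarith)
  rcases le_or_gt (9 / 10) s with h2 | h2
  · right
    rw [rad_eq_of_ge h2 hs.2 ha] at h
    have := le_of_tan_le (s := 1 - s) (by linarith [hs.2]) (by linarith) (by linarith)
    linarith
  · exfalso
    have := bentStrip_snd_ge ⟨h1.le, h2.le⟩ ha
    rw [rad] at h
    linarith

/-- Near the ends the radius does not depend on the slice point. [folklore] -/
theorem rad_eq_rad_of_end {s : ℝ} (hs : s ∈ Icc (0 : ℝ) 1) (hend : s ≤ 1 / 10 ∨ 9 / 10 ≤ s)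
    {ζ ζ' : ℂ} (hζ : ‖ζ‖ ≤ 5 / 2) (hζ' : ‖ζ'‖ ≤ 5 / 2) : rad s (aOf s ζ') = rad s (aOf s ζ) := by
  rcases hend with h | h
  · rw [rad_eq_of_le hs.1 h (abs_aOf_le s hζ), rad_eq_of_le hs.1 h (abs_aOf_le s hζ')]
  · rw [rad_eq_of_ge h hs.2 (abs_aOf_le s hζ), rad_eq_of_ge h hs.2 (abs_aOf_le s hζ')]

/-- **Band membership is a property of the slice**: for two slice points over the same `s`,
one handle point lies in the band `‖w‖ < 197/200` iff the other does. [folklore] -/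
theorem rad_lt_iff {s : ℝ} (hs : s ∈ Icc (0 : ℝ) 1) {ζ ζ' : ℂ} (hζ : ‖ζ‖ ≤ 5 / 2)
    (hζ' : ‖ζ'‖ ≤ 5 / 2) : rad s (aOf s ζ') < 197 / 200 ↔ rad s (aOf s ζ) < 197 / 200 := by
  constructor <;> intro h
  · rcases end_of_rad_lt hs hζ' h with h1 | h1
    · rwa [rad_eq_rad_of_end hs (Or.inl (by linarith)) hζ' hζ]
    · rwa [rad_eq_rad_of_end hs (Or.inr (by linarith)) hζ' hζ]
  · rcases end_of_rad_lt hs hζ h with h1 | h1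
    · rwa [rad_eq_rad_of_end hs (Or.inl (by linarith)) hζ hζ']
    · rwa [rad_eq_rad_of_end hs (Or.inr (by linarith)) hζ hζ']

/-- **`Φ_H` preserves band membership.** [folklore] -/
theorem norm_PhiH_snd_lt_iff {q : sphere (0 : EuclideanSpace ℝ (Fin 3)) 1 × EuclideanSpace ℝ (Fin 2)}
    (hq : q ∈ Hset) : ‖(PhiH q).2‖ < 197 / 200 ↔ ‖q.2‖ < 197 / 200 := by
  have hU := handleInv_mem_Ubox hq
  obtain ⟨hs, hζ, _⟩ := Ubox_aux hU
  obtain ⟨_, hζ', _⟩ := Ubox_aux (ThetaS_mem_Ubox hU)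
  conv_rhs => rw [← handleMap_handleInv_of_mem hq]
  rw [PhiH, gluckMapInv_snd,
    show handleMap (ThetaS (handleInv q)) = handleMap ((handleInv q).1, (ThetaS (handleInv q)).2.1,
      (ThetaS (handleInv q)).2.2) from rfl,
    show handleMap (handleInv q) = handleMap ((handleInv q).1, (handleInv q).2.1,
      (handleInv q).2.2) from rfl,
    norm_handleMap_snd hs hζ', norm_handleMap_snd hs hζ]
  exact rad_lt_iff hs hζ hζ'

/-- **`Ψ_H` preserves band membership.** [folklore] -/
theorem norm_PsiH_snd_lt_iff {q : sphere (0 : EuclideanSpace ℝ (Fin 3)) 1 × EuclideanSpace ℝ (Fin 2)}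
    (hq : gluckMap q ∈ Hset) : ‖(PsiH q).2‖ < 197 / 200 ↔ ‖q.2‖ < 197 / 200 := by
  have hU := handleInv_mem_Ubox hq
  obtain ⟨hs, hζ, _⟩ := Ubox_aux hU
  obtain ⟨_, hζ', _⟩ := Ubox_aux (ThetaSInv_mem_Ubox hU)
  conv_rhs => rw [← gluckMap_snd q, ← handleMap_handleInv_of_mem hq]
  rw [PsiH,
    show handleMap (ThetaSInv (handleInv (gluckMap q))) = handleMap ((handleInv (gluckMap q)).1,
      (ThetaSInv (handleInv (gluckMap q))).2.1, (ThetaSInv (handleInv (gluckMap q))).2.2) from rfl,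
    show handleMap (handleInv (gluckMap q)) = handleMap ((handleInv (gluckMap q)).1,
      (handleInv (gluckMap q)).2.1, (handleInv (gluckMap q)).2.2) from rfl,
    norm_handleMap_snd hs hζ', norm_handleMap_snd hs hζ]
  exact rad_lt_iff hs hζ hζ'

/-! ### Agreement with the polar model on the band -/

/-- The two `A`-functions agree: `1 - G(‖ζ‖²) e^{-ic} = 1 - g(x)/(r e^{ic})` when
`G(‖ζ‖²) = g(x)/r`. [folklore] -/
theorem afun_eq_polar_afun {G : ℝ → ℝ} {x r c : ℝ} {ζ : ℂ} (hr : r ≠ 0)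
    (hG : G (‖ζ‖ ^ 2) = IwasePolar.gprof x / r) :
    afun G (ζ, c) = IwasePolar.afun x (↑r * Complex.exp (↑c * Complex.I)) := by
  have hn : Complex.normSq (↑r * Complex.exp (↑c * Complex.I)) = r ^ 2 := by
    rw [Complex.normSq_eq_norm_sq, norm_mul, Complex.norm_real, Complex.norm_exp_ofReal_mul_I,
      mul_one, Real.norm_eq_abs, sq_abs]
  have hre : (↑r * Complex.exp (↑c * Complex.I)).re = r * cos c := by
    simp [Complex.exp_ofReal_mul_I_re]
  have him : (↑r * Complex.exp (↑c * Complex.I)).im = r * sin c := by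
    simp [Complex.exp_ofReal_mul_I_im]
  apply Complex.ext
  · simp only [afun_re, IwasePolar.afun_re, hn, hre]
    rw [hG]
    field_simp
  · simp only [afun_im, IwasePolar.afun_im, hn, him]
    rw [hG]
    field_simp

/-- The slice cut-off is the polar cut-off: `x/(1 - r) + c² - 4 = ‖ζ‖² + c² - 4` when
`x = (1 - r)‖ζ‖²`, `‖w‖ = r ∈ [49/50, 1)`, `arg w = c`. [folklore] -/
theorem cutoff_eq_muP {x r c : ℝ} {ζ : ℂ} (hr1 : 49 / 50 ≤ r) (hr2 : r < 1) (hc : c ∈ Ioc (-π) π)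
    (hx : x = (1 - r) * ‖ζ‖ ^ 2) :
    cutoff (ζ, c) = IwasePolar.muP x (↑r * Complex.exp (↑c * Complex.I)) := by
  have hr0 : 0 < r := by linarith
  have h1r : (1 : ℝ) - r ≠ 0 := (by linarith : (0 : ℝ) < 1 - r).ne'
  have hnorm : ‖(↑r * Complex.exp (↑c * Complex.I) : ℂ)‖ = r := by
    rw [norm_mul, Complex.norm_real, Complex.norm_exp_ofReal_mul_I, mul_one,
      Real.norm_of_nonneg hr0.le]
  have harg : Complex.arg (↑r * Complex.exp (↑c * Complex.I)) = c := by
    rw [Complex.exp_mul_I]; exact Complex.arg_mul_cos_add_sin_mul_I hr0 hc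
  rw [IwasePolar.muP, hnorm, IwasePolar.mu1_eq_one (by nlinarith), one_mul, IwasePolar.inner, hnorm,
    harg, cutoff, sqRad, hx]
  congr 1
  simp only
  rw [mul_div_cancel_left₀ _ h1r]

/-- **The raw slice phase is the polar `B`-function on the band.**  Here `x = K(s)‖ζ‖²`,
`w = r e^{ic}` with `r = 49/50 + tan (π s)`, `K(s) = 1 - r`, and the profile is `gaff m(s)`,
`m = K/(1 - K)`; where the cut-off is incomplete, `‖ζ‖² < 5` forces `x < 1/10`, where the bump
profile `g` is affine. [folklore] -/
theorem phaseRaw_eq_bfun {s : ℝ} (hs0 : 0 ≤ s) (hs : s ≤ 1 / 500) {ζ : ℂ} {c : ℝ}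
    (hc : c ∈ Ioc (-π) π) :
    phaseRaw (prof s) cutoff (ζ, c) =
      IwasePolar.bfun (Kfun s * ‖ζ‖ ^ 2)
        (↑(49 / 50 + tan (π * s)) * Complex.exp (↑c * Complex.I)) := by
  have hK : Kfun s = 1 / 50 - tan (π * s) := Kfun_eq_of_le hs0 hs
  have htan0 : 0 ≤ tan (π * s) := by
    have hπ3 : 3 < π := pi_gt_three
    exact tan_nonneg_of_nonneg_of_le_pi_div_two (by positivity) (by nlinarith [pi_pos])
  have hKle : Kfun s ≤ 1 / 50 := by rw [hK]; linarith
  have hKpos := Kfun_pos s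
  set r : ℝ := 49 / 50 + tan (π * s) with hr_def
  have hKr : Kfun s = 1 - r := by rw [hK, hr_def]; ring
  have hr1 : 49 / 50 ≤ r := by rw [hr_def]; linarith
  have hr2 : r < 1 := by linarith
  have hμ : cutoff (ζ, c) = IwasePolar.muP (Kfun s * ‖ζ‖ ^ 2) (↑r * Complex.exp (↑c * Complex.I)) :=
    cutoff_eq_muP hr1 hr2 hc (by rw [hKr])
  rw [phaseRaw, IwasePolar.bfun, ← hμ]
  by_cases h1 : cutoff (ζ, c) = 1
  · simp [h1]
  · -- incomplete cut-off: `‖ζ‖² < 5`, so `x < 1/10` and the profiles match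
    have hsq : ‖ζ‖ ^ 2 < 5 := by
      by_contra hcon
      push Not at hcon
      exact h1 (cutoff_eq_one (by simp only [sqRad]; nlinarith [sq_nonneg c]))
    have hx : Kfun s * ‖ζ‖ ^ 2 ≤ 1 / 10 := by nlinarith [norm_nonneg ζ]
    have hr0 : (0 : ℝ) < r := by linarith
    have hG : prof s (‖ζ‖ ^ 2) = IwasePolar.gprof (Kfun s * ‖ζ‖ ^ 2) / r := by
      rw [IwasePolar.gprof_of_le hx, prof, gaff, mfun, hKr, eq_div_iff hr0.ne',
        show (1 : ℝ) - (1 - r) = r by ring]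
      field_simp
      ring
    rw [afun_eq_polar_afun hr0.ne' hG]

/-- **Agreement on the northern band**: for a box point with `s ≤ 1/500` off the core,
`Φ_H = Φ_N` (the polar model `IwasePolar.polarMap`). [cite: Iwase1988, proof of Prop. 3.5 (p. 297)] -/
theorem PhiH_eq_polarMap_north {s : ℝ} {ζ : ℂ} {c : ℝ} (hu : ((s, ζ, c) : ℝ × ℂ × ℝ) ∈ Ubox)
    (hs : s ≤ 1 / 500) (hcore : ((ζ, c) : ℂ × ℝ) ∉ UnknotSurgery.unknot) :
    PhiH (handleMap (s, ζ, c)) = IwasePolar.polarMap (handleMap (s, ζ, c)) := by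
  obtain ⟨hs01, hζ, hc⟩ := Ubox_aux hu
  have hs0 : 0 ≤ s := hs01.1
  have hs10 : s ≤ 1 / 10 := by linarith
  have hadm := prof_admissible s
  have h1 := prof_eq_one s
  set ph : ℂ := phase (prof s) cutoff (ζ, c) with hph
  have hph1 : ‖ph‖ = 1 := norm_phase hadm h1 hcore
  -- the handle point
  set P := (handleMap (s, ζ, c)).1 with hP
  set w := (handleMap (s, ζ, c)).2 with hw
  have hw0 : w ≠ 0 := handleMap_snd_ne_zero hu
  have hq : handleMap (s, ζ, c) = (P, w) := rfl
  -- `Φ_H`: equivariance at the end, then the inverse Gluck rotation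
  have hΘ : ThetaS (s, ζ, c) = (s, ph * ζ, c) := rfl
  have hequi : handleMap (s, ph * ζ, c) = (rotateSphereTwo (IwasePolar.circleOf ph) P, w) :=
    handleMap_mul_of_le hs0 hs10 hζ hph1 c
  have hunit : ‖nrm (toC w)‖ = 1 := norm_nrm (IwasePolar.toC_ne_zero_of_ne_zero hw0)
  -- the phase identity
  have hwval : toC w = ↑(49 / 50 + tan (π * s)) * Complex.exp (↑c * Complex.I) := by
    rw [hw, handleMap_snd_of_le hs0 hs10 hζ, toC_wOf]
  have hnw : 17 / 20 ≤ ‖toC w‖ := by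
    rw [norm_toC, hw, norm_handleMap_snd hs01 hζ]
    linarith [le_rad hs01 (neg_one_lt_aOf s hζ)]
  have key : IwasePolar.polS P w = (nrm (toC w))⁻¹ * ph := by
    rw [IwasePolar.polS, IwasePolar.pol_eq_highPol hnw, IwasePolar.highPol, hph, phase, hP,
      xsq_handleMap_of_le hs0 hs10 hζ, kfun_sq, hwval, phaseRaw_eq_bfun hs0 hs hc]
  rw [PhiH_handleMap hu, hΘ, hequi,
    gluckMapInv_eq_of_ne_zero (p := (rotateSphereTwo (IwasePolar.circleOf ph) P, w)) hw0, hq,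
    IwasePolar.polarMap]
  simp only
  rw [← IwasePolar.circleOf_nrm_toC hw0, ← IwasePolar.circleOf_inv hunit,
    rotateSphereTwo_circleOf_mul (by rw [norm_inv, hunit, inv_one]) hph1, ← key]

/-- **Agreement on the whole band**: for `q ∈ H` with `‖w‖ < 197/200` off the core,
`Φ_H q = Φ_N q`. [cite: Iwase1988, proof of Prop. 3.5 (p. 297)] -/
theorem PhiH_eq_polarMap {q : sphere (0 : EuclideanSpace ℝ (Fin 3)) 1 × EuclideanSpace ℝ (Fin 2)}
    (hq : q ∈ Hset) (hN : ‖q.2‖ < 197 / 200) (hcore : (handleInv q).2 ∉ UnknotSurgery.unknot) :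
    PhiH q = IwasePolar.polarMap q := by
  have hq' : q ∈ handleMap '' Ubox := by rw [image_handleMap_Ubox]; exact hq
  obtain ⟨⟨s, ζ, c⟩, hu, rfl⟩ := hq'
  rw [handleInv_handleMap_of_mem hu] at hcore
  obtain ⟨hs01, hζ, hc⟩ := Ubox_aux hu
  rw [norm_handleMap_snd hs01 hζ] at hN
  rcases end_of_rad_lt hs01 hζ hN with h | h
  · exact PhiH_eq_polarMap_north hu h hcore
  · -- the southern band, by the mirror symmetry
    have hu' : ((1 - s, ζ, c) : ℝ × ℂ × ℝ) ∈ Ubox :=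
      ⟨⟨by linarith [hu.1.2], by linarith [hu.1.1]⟩, hu.2.1, hu.2.2⟩
    have hnorth := PhiH_eq_polarMap_north hu' (by linarith) hcore
    have hmir : handleMap (s, ζ, c) = (mirrorS2 (handleMap (1 - s, ζ, c)).1,
        (handleMap (1 - s, ζ, c)).2) := by
      rw [← handleMap_one_sub, sub_sub_cancel]
    rw [hmir, PhiH_mirror (handleMap_mem_Hset hu'), polarMap_mirror, hnorth]
    rfl

end IwaseHandle
end Literature.Topology.FourManifolds
end
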